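import Summits.ABC.ABC.Theorems.FeketeScalesAssembly
import Summits.ABC.ABC.Theorems.FeketeScalesSubmultOfRST
import Summits.ABC.ABC.Theorems.FeketeScalesScaleSubmultiplicativityOfEnvelopeOfPowerShapes

/-!
# Crux `ScaleSubmultiplicativity` (stmt-ABC-2160): normal forms, II — the constant, the exponent, the order

Companion of `FeketeScalesScaleSubmultiplicativityNormalForms.lean` (G-form, threshold `R₀ = 2`, census form).
The crux of route `FeketeScales` (ABC/ABC) reads, G-free,
`∃ θ < 1, ∃ K > 0, ∃ R₀, ∀ R₁ R₂ ≥ R₀, ∀ abc triple T with rad T ≤ R₁R₂, ∃ abc triples T₁, T₂ with rad Tᵢ ≤ Rᵢ and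
c ≤ K · exp((log R₁R₂)^θ) · c₁ · c₂`.  Three further consequence-free normal forms, kernel facts attached to the
crux (`--supports stmt-ABC-2160`):

* `ScaleSubmultiplicativity.iff_constant_one` — **the constant is cosmetic when the threshold is free:** the crux
  is equivalent to its instance with `K = 1` and `θ ∈ [0,1)` (`log⁺K` is absorbed into
  `(log R₁R₂)^{θ'} - (log R₁R₂)^{θ⁺}`, `θ' = (1 + θ⁺)/2`, above a threshold in the scales);
* `ScaleSubmultiplicativity.iff_exponent_ge` — `θ` may be taken in `[t, 1)` for any `t < 1` (monotonicity of the
  slack, `ScaleSubmultiplicativity.bound_mono`): only `θ → 1⁻` matters;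
* `ScaleSubmultiplicativity.iff_ordered` — ordered pairs `R₁ ≤ R₂` suffice (symmetry of the conclusion).

Together with part I: `θ` is the one structural parameter of stmt-ABC-2160; `K` and `R₀` trade against each other
(`iff_threshold_two`: `R₀ = 2` at the price of `K`; `iff_constant_one`: `K = 1` at the price of `R₀` and of
`θ' - θ`).  No bearing on provability (cf. `Cruxes/ScaleSubmultiplicativity/STRATEGY-CENSUS.md`).  Pattern: folklore
manipulations of sub-additive sequences (Fekete 1923; Pólya–Szegő I, Problem 98).
-/

-- `Summit.<Summit>.<Problem>` is the mandated summit-side namespace (CONVENTIONS §2); for the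
-- single-conjunct summit `ABC` the two coincide, so the duplicate `ABC.ABC` is deliberate.
set_option linter.dupNamespace false

namespace Summit.ABC.ABC.Theorems

open Literature.NumberTheory.DiophantineGeometry
open Summit.ABC.ABC.Theses.FeketeScales

/-! ### The constant is cosmetic when the threshold is free -/

/-- **Constant `K = 1` suffices.**  `ScaleSubmultiplicativity` (stmt-ABC-2160) is equivalent to its instance with
`K = 1` and `θ ∈ [0,1)`: with `θ⁺ = max θ 0`, `θ' = (1 + θ⁺)/2` and `s = θ' - θ⁺ > 0` one has
`log⁺K + ℓ^{θ⁺} ≤ ℓ^{θ⁺} ℓ^{s} = ℓ^{θ'}` as soon as `ℓ^s ≥ 1 + log⁺K` (`ℓ = log R₁R₂ ≥ 1`), which holds above a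
threshold in `R₁` (`SubmultOfRST.exists_threshold`). [folklore] -/
theorem ScaleSubmultiplicativity.iff_constant_one :
    Summit.ABC.ABC.Theses.FeketeScales.ScaleSubmultiplicativity ↔
    ∃ θ : ℝ, 0 ≤ θ ∧ θ < 1 ∧ ∃ R₀ : ℕ, ∀ R₁ R₂ : ℕ, R₀ ≤ R₁ → R₀ ≤ R₂ → ∀ a b c : ℕ,
      IsABCTriple a b c → rad a b c ≤ R₁ * R₂ → ∃ a₁ b₁ c₁ a₂ b₂ c₂ : ℕ, IsABCTriple a₁ b₁ c₁ ∧
        rad a₁ b₁ c₁ ≤ R₁ ∧ IsABCTriple a₂ b₂ c₂ ∧ rad a₂ b₂ c₂ ≤ R₂ ∧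
        (c : ℝ) ≤ Real.exp (Real.log ((R₁ : ℝ) * R₂) ^ θ) * c₁ * c₂ := by
  constructor
  · rintro ⟨θ, hθ1, K, hK, R₀, hS⟩
    have hN := FeketeScalesAssembly.submult_normalise hK hS
    set t : ℝ := max θ 0 with ht_def
    set L : ℝ := max (Real.log K) 0 with hL_def
    set P : ℕ := max R₀ 2 with hP_def
    have ht0 : 0 ≤ t := le_max_right _ _
    have ht1 : t < 1 := max_lt hθ1 one_pos
    have hL0 : 0 ≤ L := le_max_right _ _
    have hP2 : 2 ≤ P := le_max_right _ _
    set s : ℝ := (1 - t) / 2 with hs_def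
    have hs : 0 < s := by rw [hs_def]; linarith
    obtain ⟨N₀, hN₀⟩ := SubmultOfRST.exists_threshold (1 + L) hs
    refine ⟨(1 + t) / 2, by linarith, by linarith, max P N₀, fun R₁ R₂ hR₁ hR₂ a b c habc hrad => ?_⟩
    have hPR₁ : P ≤ R₁ := (le_max_left _ _).trans hR₁
    have hPR₂ : P ≤ R₂ := (le_max_left _ _).trans hR₂
    obtain ⟨a₁, b₁, c₁, a₂, b₂, c₂, h₁, hr₁, h₂, hr₂, hc⟩ := hN R₁ R₂ hPR₁ hPR₂ a b c habc hrad
    refine ⟨a₁, b₁, c₁, a₂, b₂, c₂, h₁, hr₁, h₂, hr₂, hc.trans ?_⟩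
    -- the scalar inequality `e^L e^{ℓ^t} ≤ e^{ℓ^{(1+t)/2}}`
    have h2R₁ : (2 : ℝ) ≤ R₁ := by exact_mod_cast hP2.trans hPR₁
    have h2R₂ : (2 : ℝ) ≤ R₂ := by exact_mod_cast hP2.trans hPR₂
    have hℓ1 : 1 ≤ Real.log ((R₁ : ℝ) * R₂) := by
      rw [Real.le_log_iff_exp_le (by positivity)]
      have he : Real.exp 1 < 3 := Real.exp_one_lt_three
      nlinarith
    have hℓ0 : 0 ≤ Real.log ((R₁ : ℝ) * R₂) := zero_le_one.trans hℓ1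
    have hthr : 1 + L ≤ Real.log ((R₁ : ℝ) * R₂) ^ s := by
      have hN₀R : N₀ ≤ R₁ * R₂ :=
        ((le_max_right _ _).trans hR₁).trans (Nat.le_mul_of_pos_right _ (by omega))
      have := hN₀ (R₁ * R₂) hN₀R
      simpa [Nat.cast_mul] using this
    have hpow1 : 1 ≤ Real.log ((R₁ : ℝ) * R₂) ^ t := Real.one_le_rpow hℓ1 ht0
    have hkey : L + Real.log ((R₁ : ℝ) * R₂) ^ t ≤ Real.log ((R₁ : ℝ) * R₂) ^ ((1 + t) / 2) := by
      have hsum : (1 + t) / 2 = t + s := by rw [hs_def]; ring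
      rw [hsum, Real.rpow_add_of_nonneg hℓ0 ht0 hs.le]
      have h0t : 0 ≤ Real.log ((R₁ : ℝ) * R₂) ^ t := Real.rpow_nonneg hℓ0 t
      calc L + Real.log ((R₁ : ℝ) * R₂) ^ t
          ≤ L * Real.log ((R₁ : ℝ) * R₂) ^ t + Real.log ((R₁ : ℝ) * R₂) ^ t := by nlinarith
        _ = Real.log ((R₁ : ℝ) * R₂) ^ t * (1 + L) := by ring
        _ ≤ Real.log ((R₁ : ℝ) * R₂) ^ t * Real.log ((R₁ : ℝ) * R₂) ^ s :=
            mul_le_mul_of_nonneg_left hthr h0t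
    have hexp : Real.exp L * Real.exp (Real.log ((R₁ : ℝ) * R₂) ^ t) ≤
        Real.exp (Real.log ((R₁ : ℝ) * R₂) ^ ((1 + t) / 2)) := by
      rw [← Real.exp_add]; exact Real.exp_le_exp.mpr hkey
    have hc0 : (0 : ℝ) ≤ (c₁ : ℝ) * c₂ := by positivity
    calc Real.exp L * Real.exp (Real.log ((R₁ : ℝ) * R₂) ^ t) * c₁ * c₂
        = (Real.exp L * Real.exp (Real.log ((R₁ : ℝ) * R₂) ^ t)) * ((c₁ : ℝ) * c₂) := by ring
      _ ≤ Real.exp (Real.log ((R₁ : ℝ) * R₂) ^ ((1 + t) / 2)) * ((c₁ : ℝ) * c₂) :=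
          mul_le_mul_of_nonneg_right hexp hc0
      _ = Real.exp (Real.log ((R₁ : ℝ) * R₂) ^ ((1 + t) / 2)) * c₁ * c₂ := by ring
  · rintro ⟨θ, -, hθ1, R₀, hS⟩
    refine ⟨θ, hθ1, 1, one_pos, R₀, fun R₁ R₂ hR₁ hR₂ a b c habc hrad => ?_⟩
    obtain ⟨a₁, b₁, c₁, a₂, b₂, c₂, h₁, hr₁, h₂, hr₂, hc⟩ := hS R₁ R₂ hR₁ hR₂ a b c habc hrad
    exact ⟨a₁, b₁, c₁, a₂, b₂, c₂, h₁, hr₁, h₂, hr₂, by rw [one_mul]; exact hc⟩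

/-! ### Only `θ → 1⁻` matters -/

/-- **The exponent may be taken in `[t, 1)` for any `t < 1`.**  Monotonicity of the slack in `θ`
(`ScaleSubmultiplicativity.bound_mono`, valid once `R₁R₂ ≥ 3`, so the threshold becomes `max R₀ 2`). [folklore] -/
theorem ScaleSubmultiplicativity.iff_exponent_ge (t : ℝ) (ht : t < 1) :
    Summit.ABC.ABC.Theses.FeketeScales.ScaleSubmultiplicativity ↔
    ∃ θ : ℝ, t ≤ θ ∧ θ < 1 ∧ ∃ K : ℝ, 0 < K ∧ ∃ R₀ : ℕ, ∀ R₁ R₂ : ℕ, R₀ ≤ R₁ → R₀ ≤ R₂ → ∀ a b c : ℕ,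
      IsABCTriple a b c → rad a b c ≤ R₁ * R₂ → ∃ a₁ b₁ c₁ a₂ b₂ c₂ : ℕ, IsABCTriple a₁ b₁ c₁ ∧
        rad a₁ b₁ c₁ ≤ R₁ ∧ IsABCTriple a₂ b₂ c₂ ∧ rad a₂ b₂ c₂ ≤ R₂ ∧
        (c : ℝ) ≤ K * Real.exp (Real.log ((R₁ : ℝ) * R₂) ^ θ) * c₁ * c₂ := by
  constructor
  · rintro ⟨θ, hθ1, K, hK, R₀, hS⟩
    refine ⟨max θ t, le_max_right _ _, max_lt hθ1 ht, K, hK, max R₀ 2, ?_⟩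
    intro R₁ R₂ hR₁ hR₂ a b c habc hrad
    obtain ⟨a₁, b₁, c₁, a₂, b₂, c₂, h₁, hr₁, h₂, hr₂, hc⟩ :=
      hS R₁ R₂ ((le_max_left _ _).trans hR₁) ((le_max_left _ _).trans hR₂) a b c habc hrad
    have hR3 : 3 ≤ R₁ * R₂ :=
      calc 3 ≤ 2 * 2 := by norm_num
        _ ≤ R₁ * R₂ := Nat.mul_le_mul ((le_max_right _ _).trans hR₁) ((le_max_right _ _).trans hR₂)
    exact ⟨a₁, b₁, c₁, a₂, b₂, c₂, h₁, hr₁, h₂, hr₂,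
      ScaleSubmultiplicativity.bound_mono (le_max_left _ _) le_rfl hK.le hR3 hc⟩
  · rintro ⟨θ, -, hθ1, K, hK, R₀, hS⟩
    exact ⟨θ, hθ1, K, hK, R₀, hS⟩

/-! ### Ordered pairs of scales suffice -/

/-- **Ordered pairs `R₁ ≤ R₂` suffice.**  The conclusion is symmetric under swapping the two witness triples, and
`log (R₁R₂) = log (R₂R₁)`. [folklore] -/
theorem ScaleSubmultiplicativity.iff_ordered :
    Summit.ABC.ABC.Theses.FeketeScales.ScaleSubmultiplicativity ↔
    ∃ θ : ℝ, θ < 1 ∧ ∃ K : ℝ, 0 < K ∧ ∃ R₀ : ℕ, ∀ R₁ R₂ : ℕ, R₀ ≤ R₁ → R₁ ≤ R₂ → ∀ a b c : ℕ,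
      IsABCTriple a b c → rad a b c ≤ R₁ * R₂ → ∃ a₁ b₁ c₁ a₂ b₂ c₂ : ℕ, IsABCTriple a₁ b₁ c₁ ∧
        rad a₁ b₁ c₁ ≤ R₁ ∧ IsABCTriple a₂ b₂ c₂ ∧ rad a₂ b₂ c₂ ≤ R₂ ∧
        (c : ℝ) ≤ K * Real.exp (Real.log ((R₁ : ℝ) * R₂) ^ θ) * c₁ * c₂ := by
  constructor
  · rintro ⟨θ, hθ1, K, hK, R₀, hS⟩
    exact ⟨θ, hθ1, K, hK, R₀, fun R₁ R₂ hR₁ h12 => hS R₁ R₂ hR₁ (hR₁.trans h12)⟩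
  · rintro ⟨θ, hθ1, K, hK, R₀, hS⟩
    refine ⟨θ, hθ1, K, hK, R₀, fun R₁ R₂ hR₁ hR₂ a b c habc hrad => ?_⟩
    rcases le_total R₁ R₂ with h12 | h21
    · exact hS R₁ R₂ hR₁ h12 a b c habc hrad
    · obtain ⟨a₁, b₁, c₁, a₂, b₂, c₂, h₁, hr₁, h₂, hr₂, hc⟩ :=
        hS R₂ R₁ hR₂ h21 a b c habc (by rwa [Nat.mul_comm] at hrad)
      refine ⟨a₂, b₂, c₂, a₁, b₁, c₁, h₂, hr₂, h₁, hr₁, ?_⟩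
      calc (c : ℝ) ≤ K * Real.exp (Real.log ((R₂ : ℝ) * R₁) ^ θ) * c₁ * c₂ := hc
        _ = K * Real.exp (Real.log ((R₁ : ℝ) * R₂) ^ θ) * c₂ * c₁ := by rw [mul_comm (R₂ : ℝ)]; ring


end Summit.ABC.ABC.Theorems
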